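import Summits.NavierStokesRegularity.NavierStokesRegularity.Theses.QuantisedSymmetry
import Literature.Analysis.FluidPDE.TypeIAncientMild
import Literature.Analysis.FluidPDE.ChaeWolfDSSDecayLtNine
import Literature.Analysis.FluidPDE.LerayHopf
import Summits.NavierStokesRegularity.NavierStokesRegularity.Theorems.QuantisedSymmetryPolyhedralDssProfileExistsStubCellConcatenation
import Summits.NavierStokesRegularity.NavierStokesRegularity.Theorems.QuantisedSymmetryPolyhedralDssProfileExistsStubOseenMildOfSlabs
import Summits.NavierStokesRegularity.NavierStokesRegularity.Theorems.QuantisedSymmetryPolyhedralDssProfileExistsStubClassicalOfOseenMildPast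
import Summits.NavierStokesRegularity.NavierStokesRegularity.Theorems.QuantisedSymmetryPolyhedralDssProfileExistsStubDssL4Propagation
import HarnessLib

/-!
# A cell with `L⁴` datum yields a Type-I DSS ancient solution; the crux
  `QuantisedSymmetry.PolyhedralDssProfileExists` follows from ONE polyhedral cell
  (crux stmt-NavierStokesRegularity-1404, line polyhedral_cell, assembly of the landed stubs)

The four bridge stubs of the line `polyhedral_cell` are tree theorems
(`stub_cellConcatenation`, `stub_oseenMild_of_slabs`, `stub_dssL4Propagation`,
`stub_classicalOfOseenMildPast`, files `…Stub{CellConcatenation, OseenMildOfSlabs, DssL4Propagation,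
ClassicalOfOseenMildPast}.lean`). This file assembles them:

* `typeIDss_of_cell` — **sector-agnostic**: for ANY subgroup `G` of the linear isometries of `ℝ³`,
  any `c > 1` and any `G`-cell `v` on the model period `[-1, -c⁻²]` (jointly continuous, bounded,
  weakly divergence free, Oseen-mild between all pairs of model times, closing up under the zoom
  `v(-c⁻², x) = c v(-1, cx)`, `G`-equivariant slice by slice) with datum `v(-1) ∈ L⁴`, there is a
  classical solution `(u, p)` of Navier–Stokes on `(-∞, 0) × ℝ³` which is an ancient mild solution
  in the duality sense with measurable slices, exactly `c`-DSS, Type I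
  (`‖u(t,x)‖ ≤ C₀/(‖x‖ + √(-t))`, by Chae–Wolf 2017 Thm 1.1 at `q = 4`), `G`-equivariant, with
  `u(-1) = v(-1)`. With `G = ⊥` this is the reduction of `Blowup.BlowupTypeIDssProfile`
  (stmt-0155) to the existence of a cell.
* `stub_profileOfPolyhedralCell` — the registered reduction: the ∃-stub of the line
  (`stub_polyhedralCellExists`: a finite, det-1, irreducible `G` and a nontrivial `G`-cell with `L⁴`
  datum) implies the crux `QuantisedSymmetry.PolyhedralDssProfileExists` by name.

So the crux IS the existence of one polyhedral cell: a fixed point, nontrivial and with `L⁴` tail,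
of the renormalisation map `𝓡_G = 𝒮_c⁻¹ ∘ Φ_NS(1 − c⁻²)` on bounded continuous `G`-symmetric
solenoidal fields (strategist census `Cruxes/PolyhedralDssProfileExists/STRATEGY-CENSUS.md`).
-/

noncomputable section

-- the summit namespace `…NavierStokesRegularity.NavierStokesRegularity…` is the tree convention (D-0017)
set_option linter.dupNamespace false

namespace Summit.NavierStokesRegularity.NavierStokesRegularity.Theorems.PolyhedralDssProfileExists.PolyhedralCell

open MeasureTheory Set Function Filter Topology
open Literature.Analysis.FluidPDE

/-- `ENNReal.ofReal 4 = 4` (the exponent of Chae–Wolf Thm 1.1 at `q = 4`). -/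
theorem ennreal_ofReal_four : ENNReal.ofReal (4 : ℝ) = (4 : ENNReal) := by
  have h : ((4 : NNReal) : ENNReal) = (4 : ENNReal) := by norm_num
  rw [← h, ← ENNReal.ofReal_coe_nnreal]
  norm_num

/-- **A cell with `L⁴` datum yields a Type-I `c`-DSS ancient solution (sector-agnostic).** For any
subgroup `G` of the linear isometries of `ℝ³`, `c > 1`, and a `G`-cell `v` on `[-1, -c⁻²]` with
`v(-1) ∈ L⁴`, the ℤ-concatenation of `v` along the zoom (`stub_cellConcatenation`, glued by
`stub_oseenMild_of_slabs`) is a classical Navier–Stokes solution on the past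
(`stub_classicalOfOseenMildPast`) with slices in `C((-∞,0); L⁴)` (`stub_dssL4Propagation`), hence
Type I by Chae–Wolf 2017 Thm 1.1 (`chaeWolf2017_dss_typeI_decay_of_lt_nine` at `q = 4`), hence in
the KNSS gauge `IsTypeIAncientMild` and an ancient mild solution in the duality sense with
measurable slices; it is exactly `c`-DSS, `G`-equivariant, and `u(-1) = v(-1)`. -/
theorem typeIDss_of_cell (G : Subgroup (EuclideanSpace ℝ (Fin 3) ≃ₗᵢ[ℝ] EuclideanSpace ℝ (Fin 3)))
    {c : ℝ} (hc : 1 < c) {v : ℝ → EuclideanSpace ℝ (Fin 3) → EuclideanSpace ℝ (Fin 3)}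
    (hcell : ContinuousOn (Function.uncurry v) (Set.Icc (-1 : ℝ) (-(c ^ 2)⁻¹) ×ˢ Set.univ) ∧
        (∃ M : ℝ, ∀ t ∈ Set.Icc (-1 : ℝ) (-(c ^ 2)⁻¹), ∀ x, ‖v t x‖ ≤ M) ∧
        (∀ t ∈ Set.Icc (-1 : ℝ) (-(c ^ 2)⁻¹), IsWeaklyDivFree (v t)) ∧
        (∀ s t : ℝ, -1 ≤ s → s < t → t ≤ -(c ^ 2)⁻¹ → ∀ x,
          v t x = heatFlow (v s) (t - s) x - oseenDuhamel 1 s v v t x) ∧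
        (∀ x, v (-(c ^ 2)⁻¹) x = c • v (-1) (c • x)) ∧
        (∀ g ∈ G, ∀ t ∈ Set.Icc (-1 : ℝ) (-(c ^ 2)⁻¹), ∀ x, v t (g x) = g (v t x)))
    (hL4 : MemLp (v (-1)) 4 volume) :
    ∃ (u : ℝ → EuclideanSpace ℝ (Fin 3) → EuclideanSpace ℝ (Fin 3))
      (p : ℝ → EuclideanSpace ℝ (Fin 3) → ℝ),
      IsClassicalNSSolutionOn (Set.Iio 0) 1 0 u p ∧ IsAncientMildSolution 1 u ∧
      (∀ t < 0, AEStronglyMeasurable (u t) volume) ∧ IsDiscretelySelfSimilar c u ∧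
      (∃ C₀ : ℝ, 0 ≤ C₀ ∧ HasTypeIDecay C₀ u ∧ IsTypeIAncientMild C₀ u) ∧
      (∀ g ∈ G, ∀ t x, u t (g x) = g (u t x)) ∧ u (-1) = v (-1) ∧
      ContinuousInLpOn (Set.Iio 0) 4 u := by
  obtain ⟨u, hcontk, hwdiv, hslab, hdss, heqv, hu1, M, hM⟩ := stub_cellConcatenation G c hc v hcell
  obtain ⟨hcont, hmild⟩ := stub_oseenMild_of_slabs c hc u hcontk ⟨M, hM⟩ hslab
  obtain ⟨p, hcl⟩ := stub_classicalOfOseenMildPast u M hcont hwdiv hmild hM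
  have hL4u : ContinuousInLpOn (Set.Iio 0) 4 u :=
    stub_dssL4Propagation c hc u M hcont hmild hM hdss (by rw [hu1]; exact hL4)
  -- Chae–Wolf 2017 Thm 1.1 at q = 4: the Type-I space–time bound
  obtain ⟨C, hC⟩ := chaeWolf2017_dss_typeI_decay_of_lt_nine 4 (by norm_num) (by norm_num) c hc u p hcl
    (fun t ht => by rw [ennreal_ofReal_four]; exact hL4u.1 t ht)
    (fun t₀ ht₀ => by rw [ennreal_ofReal_four]; exact hL4u.2 t₀ ht₀) hdss
  -- a nonnegative Type-I constant
  have hC' : HasTypeIDecay (max C 1) u := fun t ht x =>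
    (hC t ht x).trans (div_le_div_of_nonneg_right (le_max_left C 1)
      (add_nonneg (norm_nonneg x) (Real.sqrt_nonneg _)))
  have hC'0 : (0 : ℝ) ≤ max C 1 := zero_le_one.trans (le_max_right C 1)
  -- the KNSS gauge class
  have hK : IsTypeIAncientMild (max C 1) u :=
    ⟨hcl.smooth_velocity, fun t ht => hcl.divFree t ht, hmild, hC'.hasTypeITimeDecay hC'0⟩
  exact ⟨u, p, hcl, hK.isAncientMildSolution, fun t ht => hK.aestronglyMeasurable_slice ht, hdss,
    ⟨max C 1, hC'0, hC', hK⟩, heqv, hu1, hL4u⟩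

/-- **REGISTERED REDUCTION `stub_profileOfPolyhedralCell`: one polyhedral cell gives the crux.** If
there are a finite subgroup `G` of the linear isometries of `ℝ³` consisting of rotations and acting
irreducibly, a factor `c > 1`, and a `G`-cell `v` on `[-1, -c⁻²]` (jointly continuous, bounded,
weakly divergence free, Oseen-mild between all pairs of model times, closing up under the zoom,
`G`-equivariant slice by slice) whose datum `v(-1)` lies in `L⁴` and is not a.e. zero — the body of
the line's only open stub `stub_polyhedralCellExists` — then
`QuantisedSymmetry.PolyhedralDssProfileExists` holds: the witness is the concatenated field of
`typeIDss_of_cell`, nontrivial through `u(-1) = v(-1)`. -/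
theorem stub_profileOfPolyhedralCell :
    (∃ G : Subgroup (EuclideanSpace ℝ (Fin 3) ≃ₗᵢ[ℝ] EuclideanSpace ℝ (Fin 3)), Finite G ∧
    (∀ g ∈ G, LinearMap.det (g.toLinearEquiv : EuclideanSpace ℝ (Fin 3) →ₗ[ℝ] EuclideanSpace ℝ (Fin 3)) = 1) ∧
    (∀ V : Submodule ℝ (EuclideanSpace ℝ (Fin 3)), (∀ g ∈ G, ∀ v ∈ V, g v ∈ V) → V = ⊥ ∨ V = ⊤) ∧
    ∃ c : ℝ, 1 < c ∧ ∃ v : ℝ → EuclideanSpace ℝ (Fin 3) → EuclideanSpace ℝ (Fin 3),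
      (ContinuousOn (Function.uncurry v) (Set.Icc (-1 : ℝ) (-(c ^ 2)⁻¹) ×ˢ Set.univ) ∧
        (∃ M : ℝ, ∀ t ∈ Set.Icc (-1 : ℝ) (-(c ^ 2)⁻¹), ∀ x, ‖v t x‖ ≤ M) ∧
        (∀ t ∈ Set.Icc (-1 : ℝ) (-(c ^ 2)⁻¹), IsWeaklyDivFree (v t)) ∧
        (∀ s t : ℝ, -1 ≤ s → s < t → t ≤ -(c ^ 2)⁻¹ → ∀ x,
          v t x = heatFlow (v s) (t - s) x - oseenDuhamel 1 s v v t x) ∧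
        (∀ x, v (-(c ^ 2)⁻¹) x = c • v (-1) (c • x)) ∧
        (∀ g ∈ G, ∀ t ∈ Set.Icc (-1 : ℝ) (-(c ^ 2)⁻¹), ∀ x, v t (g x) = g (v t x))) ∧
      MemLp (v (-1)) 4 volume ∧ ¬ (v (-1) =ᵐ[volume] 0)) →
    Summit.NavierStokesRegularity.NavierStokesRegularity.Theses.QuantisedSymmetry.PolyhedralDssProfileExists := by
  rintro ⟨G, hfin, hdet, hirr, c, hc, v, hcell, hL4, hnt⟩
  obtain ⟨u, p, -, hanc, hmeas, hdss, ⟨C₀, -, hC₀, -⟩, heqv, hu1, -⟩ := typeIDss_of_cell G hc hcell hL4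
  refine ⟨G, hfin, hdet, hirr, c, hc, u, hanc, hmeas, hdss, ⟨C₀, hC₀⟩, heqv, ?_⟩
  -- nontriviality transfers through the slice `u(-1) = v(-1)`
  intro hzero
  apply hnt
  have h1 := hzero (-1) (by norm_num)
  rwa [hu1] at h1

end Summit.NavierStokesRegularity.NavierStokesRegularity.Theorems.PolyhedralDssProfileExists.PolyhedralCell

end
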